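import Mathlib.Data.Matrix.ColumnRowPartitioned
import Mathlib.Data.Matrix.Block
import Mathlib.Data.Matrix.Mul
import Mathlib.Data.ZMod.Basic
import Mathlib.Algebra.BigOperators.Fin
import Mathlib.Probability.ProbabilityMassFunction.Constructions
import Mathlib.Probability.Distributions.Uniform
import HarnessLib

/-!
# Gadget trapdoors for `q`-ary lattices (Micciancio–Peikert 2012)

Topic `Algebra/EuclideanLattices`. The algebraic layer of lattice TRAPDOOR GENERATION in the
gadget form of Micciancio–Peikert (EUROCRYPT 2012), for the power-of-two modulus `q = 2ᵏ`:

* the two `q`-ary lattices of a matrix `A ∈ ℤ_q^{o×ι}` (any modulus `q`):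
  `perpLattice A = Λ_q^⊥(A) = {x ∈ ℤ^ι : A x ≡ 0 (mod q)}` and
  `rowLattice A = Λ_q(Aᵗ) = {y ∈ ℤ^ι : y ≡ Aᵗ s (mod q) for some s}` as `ℤ`-submodules of `ℤ^ι`,
  with `qℤ^ι` inside both and the pairing `x ∈ Λ^⊥(A), y ∈ Λ(Aᵗ) ⇒ q ∣ ⟨x, y⟩`
  (the elementary half of `Λ_q(Aᵗ) = q · Λ_q^⊥(A)^*`);
* the gadget `g = (1, 2, 4, …, 2^{k-1})`, the block gadget matrix `G = Iₙ ⊗ g ∈ ℤ_q^{n×nk}`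
  (columns indexed by `Fin n × Fin k`), bit decomposition `gadgetInv` with `G · G⁻¹(v) = v`
  (so `G` is primitive) and injectivity of `s ↦ Gᵗ s`; the explicit basis
  `S = Iₙ ⊗ S_k` of `Λ^⊥(G)`, `S_k` bidiagonal with columns `2eₜ − eₜ₊₁` (`t < k-1`) and `2e_{k-1}`,
  all of squared norm `≤ 5` (MP12 §4, Thm. 4.1 for `q = 2ᵏ`);
* MP12 Definition 5.2: `IsGTrapdoor G A R H` — `R ∈ ℤ^{ι×κ}` is a `G`-trapdoor for
  `A ∈ ℤ_q^{o×(ι ⊕ κ)}` with invertible tag `H` when `A [R; I] = H G`; consequences: `A` is as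
  injective on the left as `G` (`s ↦ sA` injective, the LWE direction) and the block matrix
  `S_A = [[I, R],[0, I]] · [[I, 0],[W, S]]` of MP12 Lemma 5.3 has all its columns in `Λ^⊥(A)`
  whenever `H G W ≡ −A₁` and the columns of `S` lie in `Λ^⊥(G)`;
* the statistical instantiation (MP12 §5.2, Alg. 1 with `H = I`): the structure
  `GadgetTrapdoor n k m̄` = a pair `(Ā ∈ ℤ_q^{n×m̄}, R ∈ ℤ^{m̄×nk})`, its public matrix
  `A = [Ā | G − ĀR]`, the facts that `R` is a `G`-trapdoor for `A` with tag `I`, that `s ↦ sA`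
  is injective, the explicit basis `GadgetTrapdoor.perpBasis` of `Λ^⊥(A)` (columns in `Λ^⊥(A)`
  proved here; generation and the Gram–Schmidt bound `‖S̃_A‖ ≤ (s₁(R)+1)·√5` of Lemma 5.3 are
  the sequel file), and the sampler `trapGenLaw n k m̄` (`Ā` uniform, `R` uniform in
  `{0,1}^{m̄×nk}`) as a `PMF`, with its support facts.

Deliberately NOT here: the uniformity of `A` (leftover hash, MP12 §5.2 / GPV Lemma 5.1 style;
file `GadgetTrapdoorUniformity.lean`), the Gram–Schmidt analysis (file `GadgetTrapdoorBasis.lean`),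
Gaussian preimage sampling and the computational (LWE-based) instantiation of MP12 §5.2–§5.4, and
any machine-level (`RandAlg`) running-time statement for `TrapGen` (a route-side obligation).
General moduli `q` (MP12's mixed-radix gadget basis) are not treated: `q = 2ᵏ` throughout the
gadget part, as in the requesting route.

## References

* D. Micciancio, C. Peikert, *Trapdoors for lattices: simpler, tighter, faster, smaller*,
  EUROCRYPT 2012, LNCS 7237, 700–718 (full version ePrint 2011/501): §4 (primitive lattices,
  Thm. 4.1, §4.1 Prop. 4.2 for `q = 2ᵏ`), §5.1 Def. 5.2 and Lemma 5.3, §5.2 Alg. 1 and the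
  "statistical instantiation" paragraph. [MicciancioPeikert2012]
* MP12 §2.2 for the `q`-ary lattices `Λ^⊥(A)`, `Λ(Aᵗ)` and `q · Λ^⊥(A)^* = Λ(Aᵗ)`; the notions
  go back to M. Ajtai (STOC 1996) and C. Gentry, C. Peikert, V. Vaikuntanathan, *Trapdoors for hard
  lattices and new cryptographic constructions*, STOC 2008 [GentryPeikertVaikuntanathan2008].
-/

namespace Literature.Algebra.EuclideanLattices

open Matrix Finset

/-! ### `q`-ary lattices -/

section Qary

variable {q : ℕ} {o ι : Type*}

/-- Coordinatewise reduction modulo `q` of an integer vector, `x ↦ (xⱼ mod q)ⱼ ∈ ℤ_q^ι` (on `Fin m`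
the same formula as `SIS.modVec` of `Computability/Cryptography/SIS.lean`). [folklore] -/
def modQ (q : ℕ) (x : ι → ℤ) : ι → ZMod q := fun j => (x j : ZMod q)

/-- Unfolding `modQ`. [folklore] -/
@[simp] theorem modQ_apply (x : ι → ℤ) (j : ι) : modQ q x j = (x j : ZMod q) := rfl

/-- `modQ` is additive. [folklore] -/
@[simp] theorem modQ_add (x y : ι → ℤ) : modQ q (x + y) = modQ q x + modQ q y := by
  funext j; simp [modQ]

/-- `modQ 0 = 0`. [folklore] -/
@[simp] theorem modQ_zero : modQ q (0 : ι → ℤ) = 0 := by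
  funext j; simp [modQ]

/-- `modQ` commutes with negation. [folklore] -/
@[simp] theorem modQ_neg (x : ι → ℤ) : modQ q (-x) = -modQ q x := by
  funext j; simp [modQ]

/-- `modQ` is subtractive. [folklore] -/
@[simp] theorem modQ_sub (x y : ι → ℤ) : modQ q (x - y) = modQ q x - modQ q y := by
  funext j; simp [modQ]

/-- `modQ (c • x) = c • modQ x`. [folklore] -/
@[simp] theorem modQ_smul (c : ℤ) (x : ι → ℤ) : modQ q (c • x) = (c : ZMod q) • modQ q x := by
  funext j; simp [modQ]

/-- Multiples of `q` reduce to `0`. [folklore] -/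
@[simp] theorem modQ_natCast_smul (x : ι → ℤ) : modQ q ((q : ℤ) • x) = 0 := by
  funext j; simp [modQ]

/-- Lifting with `val` and reducing again is the identity. [folklore] -/
@[simp] theorem modQ_val [NeZero q] (v : ι → ZMod q) : modQ q (fun j => ((v j).val : ℤ)) = v := by
  funext j; simp [modQ]

section Perp

variable [Fintype ι]

/-- **The `q`-ary lattice `Λ_q^⊥(A) = {x ∈ ℤ^ι : A x ≡ 0 (mod q)}`** of `A ∈ ℤ_q^{o×ι}` (the "SIS
lattice", kernel of `x ↦ A x mod q`), as a `ℤ`-submodule of `ℤ^ι`.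
[cite: MicciancioPeikert2012, §2.2] -/
def perpLattice (A : Matrix o ι (ZMod q)) : Submodule ℤ (ι → ℤ) where
  carrier := {x | A *ᵥ modQ q x = 0}
  add_mem' {x y} hx hy := by
    simp only [Set.mem_setOf_eq] at hx hy ⊢
    rw [modQ_add, mulVec_add, hx, hy, add_zero]
  zero_mem' := by simp only [Set.mem_setOf_eq, modQ_zero, mulVec_zero]
  smul_mem' c x hx := by
    simp only [Set.mem_setOf_eq] at hx ⊢
    rw [modQ_smul, mulVec_smul, hx, smul_zero]

/-- Membership in `Λ_q^⊥(A)`. [cite: MicciancioPeikert2012, §2.2] -/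
theorem mem_perpLattice {A : Matrix o ι (ZMod q)} {x : ι → ℤ} :
    x ∈ perpLattice A ↔ A *ᵥ modQ q x = 0 := Iff.rfl

/-- `qℤ^ι ⊆ Λ_q^⊥(A)`. [cite: MicciancioPeikert2012, §2.2] -/
theorem qsmul_mem_perpLattice (A : Matrix o ι (ZMod q)) (x : ι → ℤ) : (q : ℤ) • x ∈ perpLattice A := by
  rw [mem_perpLattice, modQ_natCast_smul, mulVec_zero]

end Perp

section Row

variable [Fintype o]

/-- **The `q`-ary lattice `Λ_q(Aᵗ) = {y ∈ ℤ^ι : y ≡ Aᵗ s (mod q) for some s ∈ ℤ_q^o}`** (the "LWE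
lattice" generated by the rows of `A` and `qℤ^ι`), as a `ℤ`-submodule of `ℤ^ι`; `Aᵗ s` is written
`s ᵥ* A`. [cite: MicciancioPeikert2012, §2.2] -/
def rowLattice (A : Matrix o ι (ZMod q)) : Submodule ℤ (ι → ℤ) where
  carrier := {y | ∃ s : o → ZMod q, modQ q y = s ᵥ* A}
  add_mem' := by
    rintro x y ⟨s, hs⟩ ⟨t, ht⟩
    exact ⟨s + t, by rw [modQ_add, hs, ht, add_vecMul]⟩
  zero_mem' := ⟨0, by rw [modQ_zero, zero_vecMul]⟩
  smul_mem' := by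
    rintro c x ⟨s, hs⟩
    exact ⟨(c : ZMod q) • s, by rw [modQ_smul, hs, smul_vecMul]⟩

/-- Membership in `Λ_q(Aᵗ)`. [cite: MicciancioPeikert2012, §2.2] -/
theorem mem_rowLattice {A : Matrix o ι (ZMod q)} {y : ι → ℤ} :
    y ∈ rowLattice A ↔ ∃ s : o → ZMod q, modQ q y = s ᵥ* A := Iff.rfl

/-- `qℤ^ι ⊆ Λ_q(Aᵗ)`. [cite: MicciancioPeikert2012, §2.2] -/
theorem qsmul_mem_rowLattice (A : Matrix o ι (ZMod q)) (x : ι → ℤ) : (q : ℤ) • x ∈ rowLattice A :=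
  ⟨0, by rw [modQ_natCast_smul, zero_vecMul]⟩

/-- The canonical representatives: for `s ∈ ℤ_q^o` the integer lift of `sA` lies in `Λ_q(Aᵗ)`.
[cite: MicciancioPeikert2012, §2.2] -/
theorem val_vecMul_mem_rowLattice [NeZero q] (A : Matrix o ι (ZMod q)) (s : o → ZMod q) :
    (fun j => (((s ᵥ* A) j).val : ℤ)) ∈ rowLattice A :=
  ⟨s, modQ_val _⟩

end Row

variable [Fintype o] [Fintype ι]

/-- **The two `q`-ary lattices pair integrally up to `q`**: `x ∈ Λ_q^⊥(A)`, `y ∈ Λ_q(Aᵗ)` ⇒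
`q ∣ ⟨x, y⟩` (i.e. `⟨x, y/q⟩ ∈ ℤ`: the inclusion `Λ_q(Aᵗ) ⊆ q · Λ_q^⊥(A)^*`).
[cite: MicciancioPeikert2012, §2.2] -/
theorem dvd_dotProduct_of_mem_perpLattice_of_mem_rowLattice {A : Matrix o ι (ZMod q)}
    {x y : ι → ℤ} (hx : x ∈ perpLattice A) (hy : y ∈ rowLattice A) : (q : ℤ) ∣ x ⬝ᵥ y := by
  obtain ⟨s, hs⟩ := hy
  rw [← ZMod.intCast_zmod_eq_zero_iff_dvd]
  have hcast : ((x ⬝ᵥ y : ℤ) : ZMod q) = modQ q x ⬝ᵥ modQ q y := by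
    simp [dotProduct, modQ]
  rw [hcast, hs, dotProduct_comm, ← dotProduct_mulVec, mem_perpLattice.1 hx, dotProduct_zero]

end Qary

/-! ### The power-of-two gadget `G = Iₙ ⊗ (1, 2, …, 2^{k-1})` and bit decomposition -/

section Gadget

variable (n k : ℕ)

/-- **The gadget matrix** `G = Iₙ ⊗ g ∈ ℤ_q^{n×nk}`, `g = (1, 2, 4, …, 2^{k-1})`, `q = 2ᵏ`: the entry in
row `i` and column `(i', t)` is `2ᵗ` if `i = i'` and `0` otherwise (MP12 §4, "primitive matrix").
[cite: MicciancioPeikert2012, §4] -/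
def gadgetMatrix : Matrix (Fin n) (Fin n × Fin k) (ZMod (2 ^ k)) :=
  Matrix.of fun i p => if p.1 = i then (2 : ZMod (2 ^ k)) ^ (p.2 : ℕ) else 0

/-- The `t`-th binary digit of (the canonical representative of) `u ∈ ℤ_{2ᵏ}`, as an integer.
[cite: MicciancioPeikert2012, §4] -/
def bitVec (u : ZMod (2 ^ k)) : Fin k → ℤ := fun t => ((u.val / 2 ^ (t : ℕ) % 2 : ℕ) : ℤ)

/-- **Bit decomposition `G⁻¹(v)`**: the `{0,1}`-vector `w ∈ ℤ^{n×k}` with `G w = v`, `w (i, t)` = the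
`t`-th bit of `vᵢ` (MP12 §4: inverting `f_G` / sampling preimages deterministically for `q = 2ᵏ`).
[cite: MicciancioPeikert2012, §4] -/
def gadgetInv (v : Fin n → ZMod (2 ^ k)) : Fin n × Fin k → ℤ := fun p => bitVec k (v p.1) p.2

variable {n k}

/-- Bits are `0` or `1`. [folklore] -/
theorem bitVec_eq_zero_or_one (u : ZMod (2 ^ k)) (t : Fin k) : bitVec k u t = 0 ∨ bitVec k u t = 1 := by
  unfold bitVec
  rcases Nat.mod_two_eq_zero_or_one (u.val / 2 ^ (t : ℕ)) with h | h <;> simp [h]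

/-- `G⁻¹(v)` is a `{0,1}`-vector. [cite: MicciancioPeikert2012, §4] -/
theorem gadgetInv_eq_zero_or_one (v : Fin n → ZMod (2 ^ k)) (p : Fin n × Fin k) :
    gadgetInv n k v p = 0 ∨ gadgetInv n k v p = 1 :=
  bitVec_eq_zero_or_one _ _

/-- Binary expansion below `2ᵏ`: `∑_{t<k} 2ᵗ · (N / 2ᵗ mod 2) = N mod 2ᵏ`. [folklore] -/
theorem sum_range_two_pow_mul_div_mod_two (N k : ℕ) :
    ∑ t ∈ Finset.range k, 2 ^ t * (N / 2 ^ t % 2) = N % 2 ^ k := by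
  induction k with
  | zero => simp [Nat.mod_one]
  | succ k ih => rw [Finset.sum_range_succ, ih, Nat.mod_pow_succ]

/-- The bits of `u ∈ ℤ_{2ᵏ}` recombine to its canonical representative: `∑ₜ 2ᵗ · bitₜ(u) = u.val`.
[folklore] -/
theorem sum_two_pow_mul_bitVec (u : ZMod (2 ^ k)) :
    ∑ t : Fin k, (2 : ℤ) ^ (t : ℕ) * bitVec k u t = (u.val : ℤ) := by
  have h := sum_range_two_pow_mul_div_mod_two u.val k
  rw [Nat.mod_eq_of_lt (ZMod.val_lt u)] at h
  rw [← h, Nat.cast_sum, ← Fin.sum_univ_eq_sum_range]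
  simp [bitVec]

/-- The same recombination read in `ℤ_{2ᵏ}`: `∑ₜ 2ᵗ · bitₜ(u) = u`. [folklore] -/
theorem sum_two_pow_mul_bitVec_cast (u : ZMod (2 ^ k)) :
    ∑ t : Fin k, (2 : ZMod (2 ^ k)) ^ (t : ℕ) * (bitVec k u t : ZMod (2 ^ k)) = u := by
  have h := congrArg (fun z : ℤ => (z : ZMod (2 ^ k))) (sum_two_pow_mul_bitVec u)
  simpa using h

/-- Action of the gadget matrix: `(G x)ᵢ = ∑ₜ 2ᵗ x_{(i,t)}`. [cite: MicciancioPeikert2012, §4] -/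
theorem gadgetMatrix_mulVec (x : Fin n × Fin k → ZMod (2 ^ k)) (i : Fin n) :
    (gadgetMatrix n k *ᵥ x) i = ∑ t : Fin k, (2 : ZMod (2 ^ k)) ^ (t : ℕ) * x (i, t) := by
  simp only [mulVec, dotProduct, gadgetMatrix, of_apply]
  rw [Fintype.sum_prod_type, Finset.sum_eq_single i]
  · simp
  · intro i' _ hi'
    simp [hi']
  · intro h; exact absurd (Finset.mem_univ i) h

/-- Left action (the LWE direction): `(s G)_{(i,t)} = 2ᵗ sᵢ`, i.e. `Gᵗ s`.
[cite: MicciancioPeikert2012, §4] -/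
theorem vecMul_gadgetMatrix (s : Fin n → ZMod (2 ^ k)) (p : Fin n × Fin k) :
    (s ᵥ* gadgetMatrix n k) p = (2 : ZMod (2 ^ k)) ^ (p.2 : ℕ) * s p.1 := by
  simp only [vecMul, dotProduct, gadgetMatrix, of_apply]
  rw [Finset.sum_eq_single p.1]
  · simp [mul_comm]
  · intro i _ hi
    simp [Ne.symm hi]
  · intro h; exact absurd (Finset.mem_univ _) h

/-- **`G` is primitive**: `G · G⁻¹(v) = v` for every `v ∈ ℤ_q^n` (so `x ↦ G x` is onto).
[cite: MicciancioPeikert2012, §4] -/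
theorem gadgetMatrix_mulVec_gadgetInv (v : Fin n → ZMod (2 ^ k)) :
    gadgetMatrix n k *ᵥ modQ (2 ^ k) (gadgetInv n k v) = v := by
  funext i
  rw [gadgetMatrix_mulVec]
  simp only [modQ_apply, gadgetInv]
  exact sum_two_pow_mul_bitVec_cast (v i)

/-- **`s ↦ Gᵗ s` is injective** (read the coordinate `(i, 0)`: `(Gᵗ s)_{(i,0)} = sᵢ`; needs
`k ≥ 1`). [cite: MicciancioPeikert2012, §4] -/
theorem vecMul_gadgetMatrix_injective (hk : 0 < k) :
    Function.Injective fun s : Fin n → ZMod (2 ^ k) => s ᵥ* gadgetMatrix n k := by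
  intro s s' h
  funext i
  have hi := congrFun h (i, ⟨0, hk⟩)
  simpa [vecMul_gadgetMatrix] using hi

/-! ### The basis `S = Iₙ ⊗ S_k` of `Λ^⊥(G)` for `q = 2ᵏ` -/

variable (k) in
/-- Column `t` of the bidiagonal matrix `S_k ∈ ℤ^{k×k}` (MP12 §4, `q = 2ᵏ`): `2eₜ − eₜ₊₁` for
`t < k − 1` and `2e_{k−1}` for the last column. [cite: MicciancioPeikert2012, §4.1 (the matrix S_k)] -/
def gadgetBasisVec (t : Fin k) : Fin k → ℤ :=
  fun u => if u = t then 2 else if (u : ℕ) = (t : ℕ) + 1 then -1 else 0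

variable (n k) in
/-- **The basis `S = Iₙ ⊗ S_k` of `Λ^⊥(G)`**: the basis vector indexed by `(i, t)` is `S_k`'s column
`t` placed in block `i`. [cite: MicciancioPeikert2012, §4.1 (S = I_n ⊗ S_k) with Prop. 4.2] -/
def gadgetBasis (p : Fin n × Fin k) : Fin n × Fin k → ℤ :=
  fun r => if r.1 = p.1 then gadgetBasisVec k p.2 r.2 else 0

/-- `g · sₜ ≡ 0 (mod 2ᵏ)` for every column `sₜ` of `S_k`: `2·2ᵗ − 2^{t+1} = 0` for `t < k−1` and
`2·2^{k−1} = 2ᵏ ≡ 0`. [cite: MicciancioPeikert2012, §4.1 ("g^t · S_k = 0 mod q")] -/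
theorem sum_two_pow_mul_gadgetBasisVec (t : Fin k) :
    ∑ u : Fin k, (2 : ZMod (2 ^ k)) ^ (u : ℕ) * (gadgetBasisVec k t u : ZMod (2 ^ k)) = 0 := by
  classical
  -- the term `u = t` contributes `2^{t+1}`, the term `u = t+1` (if `t+1 < k`) contributes `-2^{t+1}`
  have hq : ((2 : ZMod (2 ^ k)) ^ k) = 0 := by
    have h := ZMod.natCast_self (2 ^ k)
    push_cast at h
    exact h
  by_cases hlast : (t : ℕ) + 1 = k
  · -- last column: only `u = t` contributes, `2 · 2ᵗ = 2ᵏ = 0`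
    rw [Finset.sum_eq_single t]
    · simp only [gadgetBasisVec, if_true]
      push_cast
      rw [← pow_succ, hlast, hq]
    · intro u _ hu
      have hu' : ¬ ((u : ℕ) = (t : ℕ) + 1) := fun h => by omega
      simp [gadgetBasisVec, hu, hu']
    · intro h; exact absurd (Finset.mem_univ t) h
  · have hlt : (t : ℕ) + 1 < k := by omega
    set t' : Fin k := ⟨(t : ℕ) + 1, hlt⟩ with ht'
    have htt' : t ≠ t' := fun h => by
      have := congrArg Fin.val h; simp [ht'] at this
    rw [← Finset.sum_subset (Finset.subset_univ {t, t'})]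
    · rw [Finset.sum_pair htt']
      have h1 : gadgetBasisVec k t t = 2 := by simp [gadgetBasisVec]
      have h2 : gadgetBasisVec k t t' = -1 := by
        unfold gadgetBasisVec
        rw [if_neg (Ne.symm htt'), if_pos (by simp [ht'])]
      rw [h1, h2]
      push_cast
      simp only [ht']
      ring
    · intro u _ hu
      rw [Finset.mem_insert, Finset.mem_singleton, not_or] at hu
      have hu' : ¬ ((u : ℕ) = (t : ℕ) + 1) := fun h => hu.2 (Fin.ext (by simp [ht', h]))
      simp [gadgetBasisVec, hu.1, hu']

/-- **The columns of `S` lie in `Λ^⊥(G)`** (MP12 §4.1 / Thm. 4.1: `S` is a basis of `Λ^⊥(G)`; the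
generation half is in the sequel file). [cite: MicciancioPeikert2012, Thm. 4.1 with §4.1] -/
theorem gadgetBasis_mem_perpLattice (p : Fin n × Fin k) :
    gadgetBasis n k p ∈ perpLattice (gadgetMatrix n k) := by
  classical
  rw [mem_perpLattice]
  funext i
  rw [gadgetMatrix_mulVec, Pi.zero_apply]
  by_cases hi : i = p.1
  · subst hi
    simp only [modQ_apply, gadgetBasis, if_true]
    exact sum_two_pow_mul_gadgetBasisVec p.2
  · simp [modQ_apply, gadgetBasis, hi]

/-- The entries of `S` lie in `{−1, 0, 2}`; in particular each column has squared Euclidean norm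
`≤ 5` (MP12 Prop. 4.2 / Thm. 4.1: `‖S‖ ≤ √5` for `q = 2ᵏ`). Entry-level statement; the norm
statement is in the sequel file. [cite: MicciancioPeikert2012, Prop. 4.2] -/
theorem sum_sq_gadgetBasis_le (p : Fin n × Fin k) : ∑ r, (gadgetBasis n k p r) ^ 2 ≤ 5 := by
  classical
  -- only the entries `(p.1, p.2)` (value `2`) and `(p.1, p.2 + 1)` (value `-1`) are nonzero
  have hsupp : ∀ r : Fin n × Fin k, r ∉ (Finset.univ.filter fun r : Fin n × Fin k =>
      r.1 = p.1 ∧ (r.2 = p.2 ∨ (r.2 : ℕ) = (p.2 : ℕ) + 1)) → (gadgetBasis n k p r) ^ 2 = 0 := by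
    intro r hr
    rw [Finset.mem_filter, not_and] at hr
    have hr' := hr (Finset.mem_univ r)
    simp only [gadgetBasis, gadgetBasisVec]
    split_ifs with h1 h2 h3
    · exact absurd ⟨h1, Or.inl h2⟩ hr'
    · exact absurd ⟨h1, Or.inr h3⟩ hr'
    · simp
    · simp
  rw [← Finset.sum_subset (Finset.subset_univ _) (fun r _ hr => hsupp r hr)]
  -- the filtered set has at most two elements, with the stated values
  calc ∑ r ∈ Finset.univ.filter (fun r : Fin n × Fin k => r.1 = p.1 ∧ (r.2 = p.2 ∨ (r.2 : ℕ) = (p.2 : ℕ) + 1)),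
        (gadgetBasis n k p r) ^ 2
      ≤ ∑ r ∈ Finset.univ.filter (fun r : Fin n × Fin k => r.1 = p.1 ∧ (r.2 = p.2 ∨ (r.2 : ℕ) = (p.2 : ℕ) + 1)),
        (if r.2 = p.2 then 4 else 1 : ℤ) := by
          refine Finset.sum_le_sum fun r hr => ?_
          obtain ⟨h1, h2⟩ := (Finset.mem_filter.1 hr).2
          rcases h2 with h2 | h2
          · simp [gadgetBasis, gadgetBasisVec, h1, h2]
          · have hne : r.2 ≠ p.2 := fun h => by omega
            simp [gadgetBasis, gadgetBasisVec, h1, h2, hne]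
    _ ≤ 5 := by
          have hsub : (Finset.univ.filter fun r : Fin n × Fin k => r.1 = p.1 ∧ (r.2 = p.2 ∨ (r.2 : ℕ) = (p.2 : ℕ) + 1)) ⊆
              insert p ((Finset.univ.filter fun r : Fin n × Fin k => r.1 = p.1 ∧ (r.2 : ℕ) = (p.2 : ℕ) + 1)) := by
            intro r hr
            obtain ⟨h1, h2⟩ := (Finset.mem_filter.1 hr).2
            rcases h2 with h2 | h2
            · exact Finset.mem_insert.2 (Or.inl (Prod.ext h1 h2))
            · exact Finset.mem_insert.2 (Or.inr (Finset.mem_filter.2 ⟨Finset.mem_univ _, h1, h2⟩))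
          refine (Finset.sum_le_sum_of_subset_of_nonneg hsub fun r _ _ => by positivity).trans ?_
          rw [Finset.sum_insert]
          · have hcard : (Finset.univ.filter fun r : Fin n × Fin k => r.1 = p.1 ∧ (r.2 : ℕ) = (p.2 : ℕ) + 1).card ≤ 1 := by
              refine Finset.card_le_one.2 fun a ha b hb => ?_
              obtain ⟨ha1, ha2⟩ := (Finset.mem_filter.1 ha).2
              obtain ⟨hb1, hb2⟩ := (Finset.mem_filter.1 hb).2
              exact Prod.ext (ha1.trans hb1.symm) (Fin.ext (by omega))
            have hsum : ∑ r ∈ Finset.univ.filter (fun r : Fin n × Fin k => r.1 = p.1 ∧ (r.2 : ℕ) = (p.2 : ℕ) + 1),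
                (if r.2 = p.2 then 4 else 1 : ℤ) ≤ 1 := by
              calc ∑ r ∈ Finset.univ.filter (fun r : Fin n × Fin k => r.1 = p.1 ∧ (r.2 : ℕ) = (p.2 : ℕ) + 1),
                    (if r.2 = p.2 then 4 else 1 : ℤ)
                  = ∑ r ∈ Finset.univ.filter (fun r : Fin n × Fin k => r.1 = p.1 ∧ (r.2 : ℕ) = (p.2 : ℕ) + 1), (1 : ℤ) := by
                    refine Finset.sum_congr rfl fun r hr => ?_
                    have h2 := (Finset.mem_filter.1 hr).2.2
                    have hne : r.2 ≠ p.2 := fun h => by omega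
                    simp [hne]
                _ ≤ 1 := by
                    rw [Finset.sum_const, nsmul_eq_mul, mul_one]
                    exact_mod_cast hcard
            simp only [if_true]
            linarith
          · intro hp
            have := (Finset.mem_filter.1 hp).2.2
            omega

end Gadget

/-! ### `G`-trapdoors (MP12 Definition 5.2) -/

section Trapdoor

variable {q : ℕ} {o ι κ : Type*}

section Block

variable [Fintype κ] [DecidableEq ι]

/-- **MP12 Lemma 5.3, the block matrix.** For a trapdoor `R ∈ ℤ^{ι×κ}`, a matrix `W ∈ ℤ^{κ×ι}` and a
matrix `S ∈ ℤ^{κ×κ}` (a basis of `Λ^⊥(G)`, as columns), the integer matrix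
`S_A = [[I, R],[0, I]] · [[I, 0],[W, S]] = [[I + RW, RS],[W, S]]`, whose COLUMNS are the basis
vectors of `Λ^⊥(A)`. [cite: MicciancioPeikert2012, Lemma 5.3] -/
def trapdoorBasisMatrix (R : Matrix ι κ ℤ) (W : Matrix κ ι ℤ) (S : Matrix κ κ ℤ) :
    Matrix (ι ⊕ κ) (ι ⊕ κ) ℤ :=
  Matrix.fromBlocks (1 + R * W) (R * S) W S

/-- The factorisation `S_A = [[I, R],[0, I]] · [[I, 0],[W, S]]`. [cite: MicciancioPeikert2012, Lemma 5.3] -/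
theorem trapdoorBasisMatrix_eq_mul [Fintype ι] [DecidableEq κ] (R : Matrix ι κ ℤ) (W : Matrix κ ι ℤ) (S : Matrix κ κ ℤ) :
    trapdoorBasisMatrix R W S = Matrix.fromBlocks 1 R 0 1 * Matrix.fromBlocks 1 0 W S := by
  rw [trapdoorBasisMatrix, fromBlocks_multiply]
  simp

/-- Column `c` of `S_A`, as an integer vector. [cite: MicciancioPeikert2012, Lemma 5.3] -/
def trapdoorBasisCol (R : Matrix ι κ ℤ) (W : Matrix κ ι ℤ) (S : Matrix κ κ ℤ) (c : ι ⊕ κ) :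
    ι ⊕ κ → ℤ :=
  fun r => trapdoorBasisMatrix R W S r c

end Block

variable [Fintype o] [Fintype ι] [Fintype κ] [DecidableEq o] [DecidableEq κ]

/-- **MP12 Definition 5.2 (`G`-trapdoor).** For `A ∈ ℤ_q^{o×(ι ⊕ κ)}` (columns: first the `ι`-block,
then the `κ`-block) and `G ∈ ℤ_q^{o×κ}`, the integer matrix `R ∈ ℤ^{ι×κ}` is a `G`-trapdoor for `A`
with tag `H ∈ ℤ_q^{o×o}` if `H` is invertible and `A · [R; I] = H · G`. (MP12 measure the quality of
the trapdoor by `s₁(R)`; that is not part of the definition.) [cite: MicciancioPeikert2012, Def. 5.2] -/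
def IsGTrapdoor (G : Matrix o κ (ZMod q)) (A : Matrix o (ι ⊕ κ) (ZMod q)) (R : Matrix ι κ ℤ)
    (H : Matrix o o (ZMod q)) : Prop :=
  IsUnit H ∧ A * Matrix.fromRows (R.map (Int.cast : ℤ → ZMod q)) (1 : Matrix κ κ (ZMod q)) = H * G

/-- **A trapdoor transfers left-injectivity from `G` to `A`**: if `R` is a `G`-trapdoor for `A` (any
tag) and `s ↦ sG` is injective, then `s ↦ sA` is injective — `sA = s'A` gives
`(sH)G = sA[R;I] = s'A[R;I] = (s'H)G`, so `sH = s'H`, so `s = s'`. (The LWE function `s ↦ Aᵗs` of a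
trapdoored matrix is injective.) [cite: MicciancioPeikert2012, §5 (Thm. 5.1 / Def. 5.2)] -/
theorem IsGTrapdoor.vecMul_injective {G : Matrix o κ (ZMod q)} {A : Matrix o (ι ⊕ κ) (ZMod q)}
    {R : Matrix ι κ ℤ} {H : Matrix o o (ZMod q)} (hT : IsGTrapdoor G A R H)
    (hG : Function.Injective fun s : o → ZMod q => s ᵥ* G) :
    Function.Injective fun s : o → ZMod q => s ᵥ* A := by
  intro s s' h
  have h' : (s ᵥ* A) ᵥ* Matrix.fromRows (R.map (Int.cast : ℤ → ZMod q)) 1 =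
      (s' ᵥ* A) ᵥ* Matrix.fromRows (R.map (Int.cast : ℤ → ZMod q)) 1 := by
    simp only at h; rw [h]
  rw [vecMul_vecMul, vecMul_vecMul, hT.2, ← vecMul_vecMul, ← vecMul_vecMul] at h'
  exact Matrix.vecMul_injective_of_isUnit hT.1 (hG h')

variable [DecidableEq ι]

/-- **MP12 Lemma 5.3 (membership half): the columns of `S_A` lie in `Λ^⊥(A)`.** If `R` is a
`G`-trapdoor for `A = [A₁ | A₂]` with tag `H`, `H G W ≡ −A₁ (mod q)` and every column of `S` lies in
`Λ^⊥(G)`, then `A S_A ≡ 0`: indeed `A [[I,R],[0,I]] = [A₁ | HG]` and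
`[A₁ | HG] [[I,0],[W,S]] = [A₁ + HGW | HGS] = 0`. [cite: MicciancioPeikert2012, Lemma 5.3] -/
theorem trapdoorBasisCol_mem_perpLattice {G : Matrix o κ (ZMod q)}
    {A : Matrix o (ι ⊕ κ) (ZMod q)} {R : Matrix ι κ ℤ} {H : Matrix o o (ZMod q)} (hT : IsGTrapdoor G A R H)
    {W : Matrix κ ι ℤ} (hW : H * (G * W.map (Int.cast : ℤ → ZMod q)) = -A.toCols₁)
    {S : Matrix κ κ ℤ} (hS : ∀ c : κ, (fun r => S r c) ∈ perpLattice G) (c : ι ⊕ κ) :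
    trapdoorBasisCol R W S c ∈ perpLattice A := by
  -- the product `A · S_A` over `ℤ_q` vanishes
  have hGS : G * S.map (Int.cast : ℤ → ZMod q) = 0 := by
    ext i c
    have := congrFun (mem_perpLattice.1 (hS c)) i
    simpa [mul_apply, mulVec, dotProduct, modQ] using this
  have hA : A = Matrix.fromCols A.toCols₁ A.toCols₂ := (fromCols_toCols A).symm
  have hT2 := hT.2
  rw [hA, fromCols_mul_fromRows, Matrix.mul_one] at hT2
  -- `hT2 : A₁ R + A₂ = H G`
  have e : (Int.cast : ℤ → ZMod q) = ⇑(Int.castRingHom (ZMod q)) := rfl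
  have hmap : (trapdoorBasisMatrix R W S).map (Int.cast : ℤ → ZMod q) =
      Matrix.fromBlocks (1 : Matrix ι ι (ZMod q)) (R.map (Int.cast : ℤ → ZMod q)) 0 (1 : Matrix κ κ (ZMod q)) *
        Matrix.fromBlocks (1 : Matrix ι ι (ZMod q)) 0 (W.map (Int.cast : ℤ → ZMod q)) (S.map (Int.cast : ℤ → ZMod q)) := by
    rw [trapdoorBasisMatrix_eq_mul, e, Matrix.map_mul, fromBlocks_map, fromBlocks_map,
      Matrix.map_one _ (map_zero _) (map_one _), Matrix.map_one _ (map_zero _) (map_one _),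
      Matrix.map_zero _ (map_zero _), Matrix.map_zero _ (map_zero _)]
  have h1 : A * Matrix.fromBlocks (1 : Matrix ι ι (ZMod q)) (R.map (Int.cast : ℤ → ZMod q)) 0 (1 : Matrix κ κ (ZMod q)) =
      Matrix.fromCols A.toCols₁ (H * G) := by
    conv_lhs => rw [hA]
    rw [fromCols_mul_fromBlocks, Matrix.mul_one, Matrix.mul_zero, add_zero, Matrix.mul_one, hT2]
  have h2 : Matrix.fromCols A.toCols₁ (H * G) *
      Matrix.fromBlocks (1 : Matrix ι ι (ZMod q)) 0 (W.map (Int.cast : ℤ → ZMod q)) (S.map (Int.cast : ℤ → ZMod q)) = 0 := by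
    rw [fromCols_mul_fromBlocks, Matrix.mul_one, Matrix.mul_zero, zero_add, Matrix.mul_assoc, Matrix.mul_assoc,
      hW, hGS, Matrix.mul_zero, add_neg_cancel, fromCols_zero]
  have hprod : A * (trapdoorBasisMatrix R W S).map (Int.cast : ℤ → ZMod q) = 0 := by
    rw [hmap, ← Matrix.mul_assoc, h1, h2]
  rw [mem_perpLattice]
  funext i
  have := congrFun (congrFun hprod i) c
  simpa [mul_apply, mulVec, dotProduct, modQ, trapdoorBasisCol] using this

end Trapdoor

/-! ### The Micciancio–Peikert trapdoor (statistical instantiation, tag `H = I`) -/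

/-- **A gadget trapdoor** in the form output by MP12's `GenTrap` (Alg. 1, statistical instantiation,
tag `H = I`): a pair `(Ā, R)` with `Ā ∈ ℤ_q^{n×m̄}` and `R ∈ ℤ^{m̄×nk}`, `q = 2ᵏ`; its public matrix
is `A = [Ā | G − ĀR] ∈ ℤ_q^{n×(m̄+nk)}` (`GadgetTrapdoor.pub`) and `R` is the trapdoor
(`GadgetTrapdoor.isGTrapdoor`). `GenTrap` draws `Ā` uniformly and `R` from `{0,1}^{m̄×nk}`
(`trapGenLaw`); the structure itself does not constrain `R`. [cite: MicciancioPeikert2012, §5.2 (Alg. 1) with Def. 5.2] -/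
structure GadgetTrapdoor (n k mbar : ℕ) where
  /-- The uniformly random block `Ā ∈ ℤ_q^{n×m̄}`. -/
  Abar : Matrix (Fin n) (Fin mbar) (ZMod (2 ^ k))
  /-- The trapdoor `R ∈ ℤ^{m̄×nk}` (columns indexed like the gadget's, by `Fin n × Fin k`). -/
  R : Matrix (Fin mbar) (Fin n × Fin k) ℤ

namespace GadgetTrapdoor

variable {n k mbar : ℕ} (T : GadgetTrapdoor n k mbar)

/-- The trapdoor read modulo `q`. [cite: MicciancioPeikert2012, §5.2 (Alg. 1)] -/
def Rq : Matrix (Fin mbar) (Fin n × Fin k) (ZMod (2 ^ k)) := T.R.map (Int.cast : ℤ → ZMod (2 ^ k))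

/-- **The public matrix `A = [Ā | G − ĀR] ∈ ℤ_q^{n×(m̄ ⊕ nk)}`** (MP12 Alg. 1 with `H = I`).
[cite: MicciancioPeikert2012, §5.2 (Alg. 1)] -/
def pub : Matrix (Fin n) (Fin mbar ⊕ (Fin n × Fin k)) (ZMod (2 ^ k)) :=
  Matrix.fromCols T.Abar (gadgetMatrix n k - T.Abar * T.Rq)

/-- The left block of `A` is `Ā`. [cite: MicciancioPeikert2012, §5.2 (Alg. 1)] -/
@[simp] theorem toCols₁_pub : T.pub.toCols₁ = T.Abar := by simp [pub]

/-- The right block of `A` is `G − ĀR`. [cite: MicciancioPeikert2012, §5.2 (Alg. 1)] -/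
@[simp] theorem toCols₂_pub : T.pub.toCols₂ = gadgetMatrix n k - T.Abar * T.Rq := by simp [pub]

/-- **`R` is a `G`-trapdoor for `A` with tag `I`**: `A [R; I] = ĀR + (G − ĀR) = G`.
[cite: MicciancioPeikert2012, §5.2 (Alg. 1, correctness)] -/
theorem isGTrapdoor : IsGTrapdoor (gadgetMatrix n k) T.pub T.R 1 := by
  refine ⟨isUnit_one, ?_⟩
  rw [pub, fromCols_mul_fromRows, Matrix.mul_one, Matrix.one_mul, Rq]
  abel

/-- The trapdoor identity `A [R; I] = G`, unfolded. [cite: MicciancioPeikert2012, §5.2 (Alg. 1, correctness)] -/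
theorem pub_mul_fromRows : T.pub * Matrix.fromRows T.Rq 1 = gadgetMatrix n k := by
  have h := T.isGTrapdoor.2
  rw [Matrix.one_mul] at h
  exact h

/-- **The LWE function of a trapdoored matrix is injective**: `s ↦ sA` (`= Aᵗs`) is injective on
`ℤ_q^n` (for `k ≥ 1`). [cite: MicciancioPeikert2012, §5 (Thm. 5.1: g_A invertible)] -/
theorem vecMul_pub_injective (hk : 0 < k) : Function.Injective fun s : Fin n → ZMod (2 ^ k) => s ᵥ* T.pub :=
  T.isGTrapdoor.vecMul_injective (vecMul_gadgetMatrix_injective hk)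

/-- **`A` is primitive**: `A x = u` is solvable for every `u ∈ ℤ_q^n`, by `x = [R; I] · G⁻¹(u)`.
[cite: MicciancioPeikert2012, §5 (Thm. 5.1)] -/
theorem pub_mulVec_surjective : Function.Surjective fun x : Fin mbar ⊕ (Fin n × Fin k) → ZMod (2 ^ k) => T.pub *ᵥ x := by
  intro u
  refine ⟨Matrix.fromRows T.Rq (1 : Matrix (Fin n × Fin k) (Fin n × Fin k) (ZMod (2 ^ k))) *ᵥ
    modQ (2 ^ k) (gadgetInv n k u), ?_⟩
  simp only
  rw [mulVec_mulVec, pub_mul_fromRows, gadgetMatrix_mulVec_gadgetInv]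

/-- The matrix `W ∈ {0,1}^{nk×m̄}` of MP12 Lemma 5.3 for tag `I`: column `i` is `G⁻¹(−āᵢ)`, so that
`G W = −Ā`. [cite: MicciancioPeikert2012, Lemma 5.3] -/
def W : Matrix (Fin n × Fin k) (Fin mbar) ℤ :=
  Matrix.of fun p i => gadgetInv n k (fun r => -T.Abar r i) p

/-- `G W ≡ −Ā (mod q)`. [cite: MicciancioPeikert2012, Lemma 5.3] -/
theorem gadgetMatrix_mul_W : gadgetMatrix n k * T.W.map (Int.cast : ℤ → ZMod (2 ^ k)) = -T.Abar := by
  ext r i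
  have h := congrFun (gadgetMatrix_mulVec_gadgetInv (n := n) (k := k) fun r => -T.Abar r i) r
  rw [Matrix.neg_apply, ← h]
  simp [mul_apply, mulVec, dotProduct, W, modQ]

variable (n k) in
/-- The matrix `S ∈ ℤ^{nk×nk}` whose column `p` is the gadget basis vector `gadgetBasis n k p`
(`S = Iₙ ⊗ S_k`). [cite: MicciancioPeikert2012, Thm. 4.1] -/
def gadgetS : Matrix (Fin n × Fin k) (Fin n × Fin k) ℤ := Matrix.of fun r p => gadgetBasis n k p r

/-- **The explicit basis `S_A = [[I + RW, RS],[W, S]] ∈ ℤ^{m×m}` of `Λ^⊥(A)`** (MP12 Lemma 5.3 with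
the power-of-two gadget basis), columns = basis vectors; computable from `(Ā, R)` by integer
matrix arithmetic. [cite: MicciancioPeikert2012, Lemma 5.3] -/
def perpBasisMatrix : Matrix (Fin mbar ⊕ (Fin n × Fin k)) (Fin mbar ⊕ (Fin n × Fin k)) ℤ :=
  trapdoorBasisMatrix T.R T.W (gadgetS n k)

/-- The `c`-th basis vector of `Λ^⊥(A)` (column `c` of `S_A`). [cite: MicciancioPeikert2012, Lemma 5.3] -/
def perpBasis (c : Fin mbar ⊕ (Fin n × Fin k)) : Fin mbar ⊕ (Fin n × Fin k) → ℤ :=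
  trapdoorBasisCol T.R T.W (gadgetS n k) c

/-- Unfolding a basis vector as a column of `S_A`. [cite: MicciancioPeikert2012, Lemma 5.3] -/
theorem perpBasis_apply (c r : Fin mbar ⊕ (Fin n × Fin k)) : T.perpBasis c r = T.perpBasisMatrix r c := rfl

/-- **Every basis vector lies in `Λ^⊥(A)`** (MP12 Lemma 5.3 for the MP12 trapdoor).
[cite: MicciancioPeikert2012, Lemma 5.3] -/
theorem perpBasis_mem_perpLattice (c : Fin mbar ⊕ (Fin n × Fin k)) : T.perpBasis c ∈ perpLattice T.pub := by
  refine trapdoorBasisCol_mem_perpLattice T.isGTrapdoor ?_ (fun p => ?_) c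
  · rw [Matrix.one_mul, gadgetMatrix_mul_W, toCols₁_pub]
  · exact gadgetBasis_mem_perpLattice p

/-- The gadget block of the basis: column `inr p` of `S_A` is `(R sₚ ; sₚ)`.
[cite: MicciancioPeikert2012, Lemma 5.3] -/
theorem perpBasis_inr (p : Fin n × Fin k) :
    T.perpBasis (Sum.inr p) = Sum.elim (T.R *ᵥ gadgetBasis n k p) (gadgetBasis n k p) := by
  funext r
  rcases r with i | r
  · simp [perpBasis, trapdoorBasisCol, trapdoorBasisMatrix, gadgetS, mul_apply, mulVec, dotProduct]
  · simp [perpBasis, trapdoorBasisCol, trapdoorBasisMatrix, gadgetS]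

/-- The identity block of the basis: column `inl i` of `S_A` is `(eᵢ + R wᵢ ; wᵢ)` with
`wᵢ = G⁻¹(−āᵢ)`. [cite: MicciancioPeikert2012, Lemma 5.3] -/
theorem perpBasis_inl (i : Fin mbar) :
    T.perpBasis (Sum.inl i) =
      Sum.elim (Pi.single i 1 + T.R *ᵥ fun p => T.W p i) (fun p => T.W p i) := by
  funext r
  rcases r with j | r
  · simp [perpBasis, trapdoorBasisCol, trapdoorBasisMatrix, mul_apply, mulVec, dotProduct, one_apply,
      Pi.single_apply, eq_comm]
  · simp [perpBasis, trapdoorBasisCol, trapdoorBasisMatrix]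

/-- The entries of `W` are bits. [cite: MicciancioPeikert2012, Lemma 5.3] -/
theorem W_eq_zero_or_one (p : Fin n × Fin k) (i : Fin mbar) : T.W p i = 0 ∨ T.W p i = 1 := by
  simp only [W, Matrix.of_apply]
  exact gadgetInv_eq_zero_or_one _ _

end GadgetTrapdoor

/-! ### The sampler `GenTrap` (statistical instantiation) as a distribution -/

section TrapGen

variable (n k mbar : ℕ)

/-- The `{0,1}`-matrix of a Boolean matrix. [folklore] -/
def boolMatrix {α β : Type*} (B : Matrix α β Bool) : Matrix α β ℤ := B.map fun b => if b then 1 else 0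

/-- **MP12 `GenTrap`, statistical instantiation with tag `I` and `q = 2ᵏ`, as a law**: draw
`Ā ← U(ℤ_q^{n×m̄})` and `R ← U({0,1}^{m̄×nk})` independently and output the trapdoor pair `(Ā, R)`
(its public matrix is `GadgetTrapdoor.pub`). MP12 allow any distribution for `R` making `(Ā, ĀR)`
near-uniform (e.g. `{0,±1}`-valued or discrete Gaussian); the `{0,1}` choice is GPV/Alwen–Peikert
style and is the one whose leftover-hash analysis the tree has. [cite: MicciancioPeikert2012, §5.2 (Alg. 1, statistical instantiation)] -/
noncomputable def trapGenLaw : PMF (GadgetTrapdoor n k mbar) :=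
  (PMF.uniformOfFintype (Matrix (Fin n) (Fin mbar) (ZMod (2 ^ k)))).bind fun Abar =>
    (PMF.uniformOfFintype (Matrix (Fin mbar) (Fin n × Fin k) Bool)).map fun B => ⟨Abar, boolMatrix B⟩

variable {n k mbar}

/-- Entries of a `{0,1}`-matrix. [folklore] -/
theorem boolMatrix_eq_zero_or_one {α β : Type*} (B : Matrix α β Bool) (i : α) (j : β) :
    boolMatrix B i j = 0 ∨ boolMatrix B i j = 1 := by
  unfold boolMatrix; cases B i j <;> simp

/-- **Support of `GenTrap`**: every sampled trapdoor `R` is a `{0,1}`-matrix.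
[cite: MicciancioPeikert2012, §5.2 (Alg. 1)] -/
theorem R_eq_zero_or_one_of_mem_support_trapGenLaw {T : GadgetTrapdoor n k mbar}
    (hT : T ∈ (trapGenLaw n k mbar).support) (i : Fin mbar) (p : Fin n × Fin k) : T.R i p = 0 ∨ T.R i p = 1 := by
  simp only [trapGenLaw, PMF.mem_support_bind_iff, PMF.mem_support_map_iff] at hT
  obtain ⟨Abar, -, B, -, rfl⟩ := hT
  exact boolMatrix_eq_zero_or_one B i p

variable (n k mbar) in
/-- The law of the public matrix `A = [Ā | G − ĀR]` under `GenTrap`. [cite: MicciancioPeikert2012, §5.2 (Alg. 1)] -/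
noncomputable def trapGenPubLaw : PMF (Matrix (Fin n) (Fin mbar ⊕ (Fin n × Fin k)) (ZMod (2 ^ k))) :=
  (trapGenLaw n k mbar).map GadgetTrapdoor.pub

end TrapGen

end Literature.Algebra.EuclideanLattices
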